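import Summits.KontsevichZagierPeriods.KontsevichZagierPeriods.Theorems.IsogenyCertificatesBiellipticRealPeriodCellStubAssembly
import Summits.KontsevichZagierPeriods.KontsevichZagierPeriods.Theorems.IsogenyCertificatesBiellipticRealPeriodCellStubHalfMoves
import Summits.KontsevichZagierPeriods.KontsevichZagierPeriods.Theorems.IsogenyCertificatesXMapKernelCellsUnconditional

/-!
# Census verification artifact — the Sa-assembly closes `BiellipticRealPeriodCell`
(stmt-KontsevichZagierPeriods-18685; crux-strategist seat `cstrat-…-18685-s1`, 2026-08-17)

SCRATCH / EVIDENCE ONLY — NOT a proposal. This file is the checked form of the STRATEGY-CENSUS claim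
"the live line `Sketch` has no open mathematical step: its one open stub
`stub_assembly_of_halfMovesSa` is the LANDED assembly (p144190) with the semialgebraicity
hypothesis of the LANDED half-moves (p144820) threaded through six call sites". It is obtained from
the landed `…StubAssembly.lean` MECHANICALLY: the statement of `stub_assembly` with
`IsSemialgebraic ℚ {x | x 0 ∈ Ioo α β}` inserted after `α < β →` in both conjuncts of hypothesis F,
and the proof of `stub_assembly` verbatim except that the three facts it already computed
(`_hsap`, `_hsan`, `_hsaK`, from `IntegralRep.isSemialgebraic_domain`) are now passed to `hF.1`/`hF.2`.
Then `BiellipticRealPeriodCell_of_landed` = transfer principle (12 lines, as in the ideators'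
`kernel_transfer`) + cell (i) `XMapKernelCells.realPeriodCellKernel_relations` (p119755) + the landed
stubs A, B, C, G, DE, F. The stub itself belongs to the lead `prover-line-stmt-…-18685-0`; this file
only certifies that nothing but re-threading remains (and is a ready fallback should that seat die).

References: M. Kontsevich, D. Zagier, *Periods* (2001), §1.2.
-/

noncomputable section

open Polynomial Set MeasureTheory
open Literature.NumberTheory.Transcendental

namespace Summit.KontsevichZagierPeriods.IsogenyCertificates.BiellipticRealPeriodCellStubs.AssemblySaCensus

open Summit.KontsevichZagierPeriods.IsogenyCertificates.BiellipticRealPeriodCellStubs.Assembly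

/-- **ASM, Sa form** — `stub_assembly` with the half-move hypothesis F in the (provable, landed) Sa
shape. Proof = the landed proof of `stub_assembly` with `hsap`/`hsan`/`hsaK` passed on.
[Kontsevich–Zagier 2001, §1.2] -/
theorem stub_assemblySa :
    (∀ (G : ℚ[X]) (q : ℚ), G.natDegree = 3 → Squarefree (G.comp (X ^ 2)) →
      0 < aeval (q : ℝ) (G.comp (X ^ 2)) →
      Bornology.IsBounded (connectedComponentIn {y : ℝ | 0 < aeval y (G.comp (X ^ 2))} (q : ℝ)) →
      ∃ α β : ℝ, α < β ∧ connectedComponentIn {y : ℝ | 0 < aeval y (G.comp (X ^ 2))} (q : ℝ) = Ioo α β ∧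
        aeval α (G.comp (X ^ 2)) = 0 ∧ aeval β (G.comp (X ^ 2)) = 0 ∧ aeval (0 : ℝ) (G.comp (X ^ 2)) ≠ 0 ∧
        ((0 : ℝ) ∈ Ioo α β → α = -β)) →
    (∀ (F : ℚ[X]) (α β : ℝ), Squarefree F → α < β →
      aeval α F = 0 → aeval β F = 0 → (∀ y ∈ Ioo α β, 0 < aeval y F) →
      IntegrableOn (fun x : Fin 1 → ℝ => 1 / Real.sqrt (aeval (x 0) F)) {x | x 0 ∈ Ioo α β}) →
    (∀ (G : ℚ[X]), G.natDegree = 3 → Squarefree (G.comp (X ^ 2)) →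
      (∃ (m s k : ℚ) (A B : ℤ), m ≠ 0 ∧ k ≠ 0 ∧ 4 * A ^ 3 + 27 * B ^ 2 ≠ 0 ∧
        ∀ y : ℝ, (m : ℝ) ^ 3 * aeval y (G.comp (X ^ 2)) =
          (k : ℝ) ^ 2 * ((y ^ 2 - s) ^ 3 + (A : ℝ) * m ^ 2 * (y ^ 2 - s) + (B : ℝ) * m ^ 3)) ∧
      (∃ (m s k : ℚ) (A B : ℤ), m ≠ 0 ∧ k ≠ 0 ∧ 4 * A ^ 3 + 27 * B ^ 2 ≠ 0 ∧
        ∀ y : ℝ, (m : ℝ) ^ 3 * aeval y (G.comp (X ^ 2)) =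
          (k : ℝ) ^ 2 * ((1 - s * y ^ 2) ^ 3 + (A : ℝ) * m ^ 2 * y ^ 4 * (1 - s * y ^ 2) +
            (B : ℝ) * m ^ 3 * y ^ 6))) →
    ((∀ (G : ℚ[X]) (m s k : ℚ) (A B : ℤ) (a₁ σ : ℚ) (α β : ℝ), m ≠ 0 → k ≠ 0 →
      (∀ y : ℝ, (m : ℝ) ^ 3 * aeval y (G.comp (X ^ 2)) =
        (k : ℝ) ^ 2 * ((y ^ 2 - s) ^ 3 + (A : ℝ) * m ^ 2 * (y ^ 2 - s) + (B : ℝ) * m ^ 3)) →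
      α < β → Literature.ModelTheory.ExponentialFields.IsSemialgebraic ℚ {x : Fin 1 → ℝ | x 0 ∈ Ioo α β} →
      ((0 ≤ α ∧ σ = 1) ∨ (β ≤ 0 ∧ σ = -1)) →
      (∀ y ∈ Ioo α β, 0 < aeval y (G.comp (X ^ 2))) →
      IntegrableOn (fun x : Fin 1 → ℝ => 1 / Real.sqrt (aeval (x 0) (G.comp (X ^ 2)))) {x | x 0 ∈ Ioo α β} →
      ∃ O t : KZ.IntegralRep 1,
        O.domain = {x | x 0 ∈ Ioo α β} ∧
        O.integrand = (fun x => (a₁ : ℝ) * x 0 / Real.sqrt (aeval (x 0) (G.comp (X ^ 2)))) ∧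
        t.domain = {x | x 0 ∈ (fun y : ℝ => (y ^ 2 - s) / m) '' Ioo α β} ∧
        EqOn t.integrand (fun x => ((σ * a₁ * |m| / (2 * |k|) : ℚ) : ℝ) /
          Real.sqrt (x 0 ^ 3 + (A : ℝ) * x 0 + (B : ℝ))) t.domain ∧
        KZ.of O - KZ.of t ∈ KZ.relations) ∧
    (∀ (G : ℚ[X]) (m s k : ℚ) (A B : ℤ) (a₀ : ℚ) (α β : ℝ), m ≠ 0 → k ≠ 0 →
      (∀ y : ℝ, (m : ℝ) ^ 3 * aeval y (G.comp (X ^ 2)) =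
        (k : ℝ) ^ 2 * ((1 - s * y ^ 2) ^ 3 + (A : ℝ) * m ^ 2 * y ^ 4 * (1 - s * y ^ 2) +
          (B : ℝ) * m ^ 3 * y ^ 6)) →
      α < β → Literature.ModelTheory.ExponentialFields.IsSemialgebraic ℚ {x : Fin 1 → ℝ | x 0 ∈ Ioo α β} →
      (0 ≤ α ∨ β ≤ 0) →
      (∀ y ∈ Ioo α β, 0 < aeval y (G.comp (X ^ 2))) →
      IntegrableOn (fun x : Fin 1 → ℝ => 1 / Real.sqrt (aeval (x 0) (G.comp (X ^ 2)))) {x | x 0 ∈ Ioo α β} →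
      ∃ E t : KZ.IntegralRep 1,
        E.domain = {x | x 0 ∈ Ioo α β} ∧
        E.integrand = (fun x => (a₀ : ℝ) / Real.sqrt (aeval (x 0) (G.comp (X ^ 2)))) ∧
        t.domain = {x | x 0 ∈ (fun y : ℝ => ((y ^ 2)⁻¹ - s) / m) '' Ioo α β} ∧
        EqOn t.integrand (fun x => ((a₀ * |m| / (2 * |k|) : ℚ) : ℝ) /
          Real.sqrt (x 0 ^ 3 + (A : ℝ) * x 0 + (B : ℝ))) t.domain ∧
        KZ.of E - KZ.of t ∈ KZ.relations)) →
    ((∀ (m s α β : ℝ), m ≠ 0 → α < β → (0 ≤ α ∨ β ≤ 0) →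
      (fun y : ℝ => (y ^ 2 - s) / m) '' Ioo α β = uIoo ((α ^ 2 - s) / m) ((β ^ 2 - s) / m)) ∧
    (∀ (m s α β : ℝ), m ≠ 0 → α < β → (0 < α ∨ β < 0) →
      (fun y : ℝ => ((y ^ 2)⁻¹ - s) / m) '' Ioo α β = uIoo (((α ^ 2)⁻¹ - s) / m) (((β ^ 2)⁻¹ - s) / m)) ∧
    (∀ (m s β : ℝ), 0 < m → 0 < β →
      (fun y : ℝ => ((y ^ 2)⁻¹ - s) / m) '' Ioo 0 β = Ioi (((β ^ 2)⁻¹ - s) / m) ∧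
      (fun y : ℝ => ((y ^ 2)⁻¹ - s) / m) '' Ioo (-β) 0 = Ioi (((β ^ 2)⁻¹ - s) / m))) →
    ((∀ (A B : ℤ) (a : ℚ) (c d : ℝ) (t : KZ.IntegralRep 1), 4 * A ^ 3 + 27 * B ^ 2 ≠ 0 → c < d →
      c ^ 3 + (A : ℝ) * c + (B : ℝ) = 0 → d ^ 3 + (A : ℝ) * d + (B : ℝ) = 0 →
      (∀ y ∈ Ioo c d, 0 < y ^ 3 + (A : ℝ) * y + (B : ℝ)) →
      t.domain = {x | x 0 ∈ Ioo c d} →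
      EqOn t.integrand (fun x => (a : ℝ) / Real.sqrt (x 0 ^ 3 + (A : ℝ) * x 0 + (B : ℝ))) t.domain →
      ∃ e ∈ AddSubgroup.closure {d : KZ.FormalRep | ∃ (A B : ℤ) (a : ℚ) (r : KZ.IntegralRep 1),
          4 * A ^ 3 + 27 * B ^ 2 ≠ 0 ∧ r.domain = {x | 0 < x 0 ^ 3 + (A : ℝ) * x 0 + (B : ℝ)} ∧
          Set.EqOn r.integrand (fun x => (a : ℝ) / Real.sqrt (x 0 ^ 3 + (A : ℝ) * x 0 + (B : ℝ))) r.domain ∧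
          d = KZ.of r},
        KZ.of t - e ∈ KZ.relations) ∧
    (∀ (A B : ℤ) (a : ℚ) (c : ℝ) (t : KZ.IntegralRep 1), 4 * A ^ 3 + 27 * B ^ 2 ≠ 0 →
      c ^ 3 + (A : ℝ) * c + (B : ℝ) = 0 → (∀ y ∈ Ioi c, 0 < y ^ 3 + (A : ℝ) * y + (B : ℝ)) →
      t.domain = {x | x 0 ∈ Ioi c} →
      EqOn t.integrand (fun x => (a : ℝ) / Real.sqrt (x 0 ^ 3 + (A : ℝ) * x 0 + (B : ℝ))) t.domain →
      ∃ e ∈ AddSubgroup.closure {d : KZ.FormalRep | ∃ (A B : ℤ) (a : ℚ) (r : KZ.IntegralRep 1),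
          4 * A ^ 3 + 27 * B ^ 2 ≠ 0 ∧ r.domain = {x | 0 < x 0 ^ 3 + (A : ℝ) * x 0 + (B : ℝ)} ∧
          Set.EqOn r.integrand (fun x => (a : ℝ) / Real.sqrt (x 0 ^ 3 + (A : ℝ) * x 0 + (B : ℝ))) r.domain ∧
          d = KZ.of r},
        KZ.of t - e ∈ KZ.relations)) →
    ∀ d ∈ {d : KZ.FormalRep | ∃ (G : Polynomial ℚ) (q a₀ a₁ : ℚ) (r : KZ.IntegralRep 1),
        G.natDegree = 3 ∧ Squarefree (G.comp (Polynomial.X ^ 2)) ∧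
        0 < Polynomial.aeval (q : ℝ) (G.comp (Polynomial.X ^ 2)) ∧
        Bornology.IsBounded (connectedComponentIn {y : ℝ | 0 < Polynomial.aeval y (G.comp (Polynomial.X ^ 2))} (q : ℝ)) ∧
        r.domain = {x | x 0 ∈ connectedComponentIn {y : ℝ | 0 < Polynomial.aeval y (G.comp (Polynomial.X ^ 2))} (q : ℝ)} ∧
        Set.EqOn r.integrand (fun x => ((a₀ : ℝ) + (a₁ : ℝ) * x 0) /
          Real.sqrt (Polynomial.aeval (x 0) (G.comp (Polynomial.X ^ 2)))) r.domain ∧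
        d = KZ.of r},
      ∃ e ∈ AddSubgroup.closure {d : KZ.FormalRep | ∃ (A B : ℤ) (a : ℚ) (r : KZ.IntegralRep 1),
          4 * A ^ 3 + 27 * B ^ 2 ≠ 0 ∧ r.domain = {x | 0 < x 0 ^ 3 + (A : ℝ) * x 0 + (B : ℝ)} ∧
          Set.EqOn r.integrand (fun x => (a : ℝ) / Real.sqrt (x 0 ^ 3 + (A : ℝ) * x 0 + (B : ℝ))) r.domain ∧
          d = KZ.of r},
        d - e ∈ KZ.relations := by
  intro hA hB hC hF hG hDE d hd
  obtain ⟨G, q, a₀, a₁, r, hdeg, hsq, hq, hbdd, hdom, hint, rfl⟩ := hd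
  obtain ⟨α, β, hαβ, hK, hFα, hFβ, hF0, hsym⟩ := hA G q hdeg hsq hq hbdd
  have hpos : ∀ y ∈ Ioo α β, 0 < aeval y (G.comp (X ^ 2)) := fun y hy =>
    connectedComponentIn_subset {y : ℝ | 0 < aeval y (G.comp (X ^ 2))} (q : ℝ)
      (by rw [hK]; exact hy)
  obtain ⟨⟨m₁, s₁, k₁, A₁, B₁, hm₁, hk₁, hΔ₁, hmod₁⟩, ⟨m₂, s₂, k₂, A₂, B₂, hm₂, hk₂, hΔ₂, hmod₂⟩⟩ :=
    hC G hdeg hsq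
  have hintK := hB (G.comp (X ^ 2)) α β hsq hαβ hFα hFβ hpos
  rw [hK] at hdom
  by_cases h0 : (0 : ℝ) ∈ Ioo α β
  · /- CENTRAL oval `K = (−β, β)` -/
    obtain rfl : α = -β := hsym h0
    have hβ : 0 < β := h0.2
    have hF0pos : 0 < aeval (0 : ℝ) (G.comp (X ^ 2)) := hpos 0 h0
    obtain ⟨rp, rn, hrpd, hrnd, hrpi, hrni, hrps, hrns, hsplit⟩ :=
      split_at_zero r (by linarith) hβ.le hdom
    have hposp : ∀ y ∈ Ioo 0 β, 0 < aeval y (G.comp (X ^ 2)) := fun y hy =>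
      hpos y ⟨by linarith [hy.1], hy.2⟩
    have hposn : ∀ y ∈ Ioo (-β) 0, 0 < aeval y (G.comp (X ^ 2)) := fun y hy =>
      hpos y ⟨hy.1, by linarith [hy.2]⟩
    have hintp : IntegrableOn (fun x : Fin 1 → ℝ => 1 / Real.sqrt (aeval (x 0) (G.comp (X ^ 2))))
        {x | x 0 ∈ Ioo 0 β} :=
      hintK.mono_set fun x hx => Ioo_subset_Ioo_left (by linarith) hx
    have hintn : IntegrableOn (fun x : Fin 1 → ℝ => 1 / Real.sqrt (aeval (x 0) (G.comp (X ^ 2))))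
        {x | x 0 ∈ Ioo (-β) 0} :=
      hintK.mono_set fun x hx => Ioo_subset_Ioo_right hβ.le hx
    -- semialgebraicity of the two halves (available for the moves of F)
    have hsap : Literature.ModelTheory.ExponentialFields.IsSemialgebraic ℚ
        {x : Fin 1 → ℝ | x 0 ∈ Ioo 0 β} := hrpd ▸ rp.isSemialgebraic_domain
    have hsan : Literature.ModelTheory.ExponentialFields.IsSemialgebraic ℚ
        {x : Fin 1 → ℝ | x 0 ∈ Ioo (-β) 0} := hrnd ▸ rn.isSemialgebraic_domain
    -- the four moves
    obtain ⟨Op, tp₁, hOpd, hOpi, htp₁d, htp₁i, hrelOp⟩ := hF.1 G m₁ s₁ k₁ A₁ B₁ a₁ 1 0 β hm₁ hk₁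
      hmod₁ hβ hsap (Or.inl ⟨le_rfl, rfl⟩) hposp hintp
    obtain ⟨Ep, tp₂, hEpd, hEpi, htp₂d, htp₂i, hrelEp⟩ := hF.2 G m₂ s₂ k₂ A₂ B₂ a₀ 0 β hm₂ hk₂ hmod₂
      hβ hsap (Or.inl le_rfl) hposp hintp
    obtain ⟨On, tn₁, hOnd, hOni, htn₁d, htn₁i, hrelOn⟩ := hF.1 G m₁ s₁ k₁ A₁ B₁ a₁ (-1) (-β) 0
      hm₁ hk₁ hmod₁ (by linarith) hsan (Or.inr ⟨le_rfl, rfl⟩) hposn hintn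
    obtain ⟨En, tn₂, hEnd, hEni, htn₂d, htn₂i, hrelEn⟩ := hF.2 G m₂ s₂ k₂ A₂ B₂ a₀ (-β) 0 hm₂ hk₂
      hmod₂ (by linarith) hsan (Or.inr le_rfl) hposn hintn
    -- rule (1b) on each half
    have h1bp : KZ.of rp - KZ.of Ep - KZ.of Op ∈ KZ.relations :=
      rule1b rp Op Ep hrpd (fun x hx => by rw [hrpi]; exact hint (hrps hx)) hOpd hOpi hEpd hEpi
    have h1bn : KZ.of rn - KZ.of En - KZ.of On ∈ KZ.relations :=
      rule1b rn On En hrnd (fun x hx => by rw [hrni]; exact hint (hrns hx)) hOnd hOni hEnd hEni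
    -- the odd targets cancel
    have hcancel : KZ.of tp₁ + KZ.of tn₁ ∈ KZ.relations :=
      odd_cancel hm₁ hβ hG.1 htp₁d htp₁i htn₁d htn₁i
    -- the even targets land on the ray from the root `φ₂ β`
    obtain ⟨c, hc, hposc, himgp, himgn⟩ := even_ray hm₂ hk₂ hmod₂ hβ hFβ hF0pos hposp hG.2.2
    obtain ⟨ep, hep, hrelp⟩ := hDE.2 A₂ B₂ (a₀ * |m₂| / (2 * |k₂|)) c tp₂ hΔ₂ hc hposc
      (by rw [htp₂d, himgp]) htp₂i
    obtain ⟨en, hen, hreln⟩ := hDE.2 A₂ B₂ (a₀ * |m₂| / (2 * |k₂|)) c tn₂ hΔ₂ hc hposc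
      (by rw [htn₂d, himgn]) htn₂i
    refine ⟨ep + en, add_mem hep hen, ?_⟩
    have : KZ.of r - (ep + en) = (KZ.of r - KZ.of rp - KZ.of rn) +
        (KZ.of rp - KZ.of Ep - KZ.of Op) + (KZ.of rn - KZ.of En - KZ.of On) +
        (KZ.of Op - KZ.of tp₁) + (KZ.of On - KZ.of tn₁) + (KZ.of tp₁ + KZ.of tn₁) +
        (KZ.of Ep - KZ.of tp₂) + (KZ.of En - KZ.of tn₂) + (KZ.of tp₂ - ep) + (KZ.of tn₂ - en) := by
      abel
    rw [this]
    exact add_mem (add_mem (add_mem (add_mem (add_mem (add_mem (add_mem (add_mem (add_mem hsplit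
      h1bp) h1bn) hrelOp) hrelOn) hcancel) hrelEp) hrelEn) hrelp) hreln
  · /- OFF-ZERO oval: `K` is one-signed -/
    have h0' : 0 ≤ α ∨ β ≤ 0 := by
      rcases le_or_gt 0 α with h | h
      · exact Or.inl h
      · exact Or.inr (le_of_not_gt fun hβ => h0 ⟨h, hβ⟩)
    obtain ⟨σ, hσ⟩ : ∃ σ : ℚ, (0 ≤ α ∧ σ = 1) ∨ (β ≤ 0 ∧ σ = -1) :=
      h0'.elim (fun h => ⟨1, Or.inl ⟨h, rfl⟩⟩) (fun h => ⟨-1, Or.inr ⟨h, rfl⟩⟩)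
    -- semialgebraicity of `K` (available for the moves of F)
    have hsaK : Literature.ModelTheory.ExponentialFields.IsSemialgebraic ℚ
        {x : Fin 1 → ℝ | x 0 ∈ Ioo α β} := hdom ▸ r.isSemialgebraic_domain
    obtain ⟨O, t₁, hOd, hOi, ht₁d, ht₁i, hrelO⟩ := hF.1 G m₁ s₁ k₁ A₁ B₁ a₁ σ α β hm₁ hk₁ hmod₁
      hαβ hsaK hσ hpos hintK
    obtain ⟨E, t₂, hEd, hEi, ht₂d, ht₂i, hrelE⟩ := hF.2 G m₂ s₂ k₂ A₂ B₂ a₀ α β hm₂ hk₂ hmod₂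
      hαβ hsaK h0' hpos hintK
    have h1b : KZ.of r - KZ.of E - KZ.of O ∈ KZ.relations := rule1b r O E hdom hint hOd hOi hEd hEi
    obtain ⟨c₁, d₁, hcd₁, hc₁, hd₁, hP₁, himg₁⟩ :=
      odd_window hm₁ hk₁ hmod₁ hαβ h0' hFα hFβ hpos hG.1
    obtain ⟨e₁, he₁, hrel₁⟩ := hDE.1 A₁ B₁ (σ * a₁ * |m₁| / (2 * |k₁|)) c₁ d₁ t₁ hΔ₁ hcd₁ hc₁ hd₁
      hP₁ (by rw [ht₁d, himg₁]) ht₁i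
    obtain ⟨c₂, d₂, hcd₂, hc₂, hd₂, hP₂, himg₂⟩ :=
      even_window hm₂ hk₂ hmod₂ hαβ h0' hFα hFβ hF0 hpos hG.2.1
    obtain ⟨e₂, he₂, hrel₂⟩ := hDE.1 A₂ B₂ (a₀ * |m₂| / (2 * |k₂|)) c₂ d₂ t₂ hΔ₂ hcd₂ hc₂ hd₂ hP₂
      (by rw [ht₂d, himg₂]) ht₂i
    refine ⟨e₁ + e₂, add_mem he₁ he₂, ?_⟩
    have : KZ.of r - (e₁ + e₂) = (KZ.of r - KZ.of E - KZ.of O) + (KZ.of O - KZ.of t₁) +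
        (KZ.of t₁ - e₁) + (KZ.of E - KZ.of t₂) + (KZ.of t₂ - e₂) := by
      abel
    rw [this]
    exact add_mem (add_mem (add_mem (add_mem h1b hrelO) hrel₁) hrelE) hrel₂


/-- The registered open stub `stub_assembly_of_halfMovesSa`, modulo bound-variable names: ASM-Sa with
the landed A, B, C, G, DE plugged in. -/
theorem stub_assembly_of_halfMovesSa_census : ((∀ (G : ℚ[X]) (m s k : ℚ) (A B : ℤ) (a₁ σ : ℚ) (α β : ℝ), m ≠ 0 → k ≠ 0 → (∀ y : ℝ, (m : ℝ) ^ 3 * aeval y (G.comp (X ^ 2)) = (k : ℝ) ^ 2 * ((y ^ 2 - s) ^ 3 + (A : ℝ) * m ^ 2 * (y ^ 2 - s) + (B : ℝ) * m ^ 3)) → α < β → Literature.ModelTheory.ExponentialFields.IsSemialgebraic ℚ {x : Fin 1 → ℝ | x 0 ∈ Ioo α β} → ((0 ≤ α ∧ σ = 1) ∨ (β ≤ 0 ∧ σ = -1)) → (∀ y ∈ Ioo α β, 0 < aeval y (G.comp (X ^ 2))) → IntegrableOn (fun x : Fin 1 → ℝ => 1 / Real.sqrt (aeval (x 0) (G.comp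 (X ^ 2)))) {x | x 0 ∈ Ioo α β} → ∃ O t : KZ.IntegralRep 1, O.domain = {x | x 0 ∈ Ioo α β} ∧ O.integrand = (fun x => (a₁ : ℝ) * x 0 / Real.sqrt (aeval (x 0) (G.comp (X ^ 2)))) ∧ t.domain = {x | x 0 ∈ (fun y : ℝ => (y ^ 2 - s) / m) '' Ioo α β} ∧ EqOn t.integrand (fun x => ((σ * a₁ * |m| / (2 * |k|) : ℚ) : ℝ) / Real.sqrt (x 0 ^ 3 + (A : ℝ) * x 0 + (B : ℝ))) t.domain ∧ KZ.of O - KZ.of t ∈ KZ.relations) ∧ (∀ (G : ℚ[X]) (m s k : ℚ) (A B : ℤ) (a₀ : ℚ) (α β : ℝ), m ≠ 0 → k ≠ 0 → (∀ y : ℝ, (m : ℝ) ^ 3 * aeval y (G.comp (X ^ 2)) = (k : ℝ) ^ 2 * ((1 - s * y ^ 2) ^ 3 + (A : ℝ) * m ^ 2 * y ^ 4 * (1 - s * y ^ 2) + (B : ℝ) * m ^ 3 * y ^ 6)) → α < β → Literature.ModelTheory.ExponentialFields.IsSemialgebraic ℚ {x : Fin 1 → ℝ | x 0 ∈ Ioo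 α β} → (0 ≤ α ∨ β ≤ 0) → (∀ y ∈ Ioo α β, 0 < aeval y (G.comp (X ^ 2))) → IntegrableOn (fun x : Fin 1 → ℝ => 1 / Real.sqrt (aeval (x 0) (G.comp (X ^ 2)))) {x | x 0 ∈ Ioo α β} → ∃ E t : KZ.IntegralRep 1, E.domain = {x | x 0 ∈ Ioo α β} ∧ E.integrand = (fun x => (a₀ : ℝ) / Real.sqrt (aeval (x 0) (G.comp (X ^ 2)))) ∧ t.domain = {x | x 0 ∈ (fun y : ℝ => ((y ^ 2)⁻¹ - s) / m) '' Ioo α β} ∧ EqOn t.integrand (fun x => ((a₀ * |m| / (2 * |k|) : ℚ) : ℝ) / Real.sqrt (x 0 ^ 3 + (A : ℝ) * x 0 + (B : ℝ))) t.domain ∧ KZ.of E - KZ.of t ∈ KZ.relations)) → ∀ d ∈ {d : KZ.FormalRep | ∃ (G : Polynomial ℚ) (q a₀ a₁ : ℚ) (r : KZ.IntegralRep 1), G.natDegree = 3 ∧ Squarefree (G.comp (Polynomial.X ^ 2)) ∧ 0 < Polynomial.aeval (q : ℝ) (G.comp (Polynomial.X ^ 2)) ∧ Bornology.IsBounded (connectedComponentIn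 {y : ℝ | 0 < Polynomial.aeval y (G.comp (Polynomial.X ^ 2))} (q : ℝ)) ∧ r.domain = {x | x 0 ∈ connectedComponentIn {y : ℝ | 0 < Polynomial.aeval y (G.comp (Polynomial.X ^ 2))} (q : ℝ)} ∧ Set.EqOn r.integrand (fun x => ((a₀ : ℝ) + (a₁ : ℝ) * x 0) / Real.sqrt (Polynomial.aeval (x 0) (G.comp (Polynomial.X ^ 2)))) r.domain ∧ d = KZ.of r}, ∃ e ∈ AddSubgroup.closure {d : KZ.FormalRep | ∃ (A B : ℤ) (a : ℚ) (r : KZ.IntegralRep 1), 4 * A ^ 3 + 27 * B ^ 2 ≠ 0 ∧ r.domain = {x | 0 < x 0 ^ 3 + (A : ℝ) * x 0 + (B : ℝ)} ∧ Set.EqOn r.integrand (fun x => (a : ℝ) / Real.sqrt (x 0 ^ 3 + (A : ℝ) * x 0 + (B : ℝ))) r.domain ∧ d = KZ.of r}, d - e ∈ KZ.relations := fun hF =>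
  stub_assemblySa ComponentShape.stub_componentShape InvSqrtIntegrable.stub_invSqrtIntegrable
    IntegralModels.stub_integralModels hF Images.stub_images ComponentLanding.stub_componentLanding

/-- **The crux, from landed theorems only.** Transfer principle: every bielliptic generator is
congruent mod `KZ.relations` to an element of the cell-(i) subgroup (ASM-Sa + landed F), relations
have value `0` (soundness), and the cell-(i) kernel statement is a theorem of the tree. -/
theorem BiellipticRealPeriodCell_of_landed :
    Summit.KontsevichZagierPeriods.KontsevichZagierPeriods.Theses.IsogenyCertificates.BiellipticRealPeriodCell := by
  intro c hc h0
  have hT := stub_assembly_of_halfMovesSa_census HalfMoves.stub_halfMoves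
  have hsub : c ∈ AddSubgroup.closure {d : KZ.FormalRep | ∃ (A B : ℤ) (a : ℚ) (r : KZ.IntegralRep 1),
      4 * A ^ 3 + 27 * B ^ 2 ≠ 0 ∧ r.domain = {x | 0 < x 0 ^ 3 + (A : ℝ) * x 0 + (B : ℝ)} ∧
      Set.EqOn r.integrand (fun x => (a : ℝ) / Real.sqrt (x 0 ^ 3 + (A : ℝ) * x 0 + (B : ℝ))) r.domain ∧
      d = KZ.of r} ⊔ KZ.relations := by
    refine (AddSubgroup.closure_le (K := _ ⊔ KZ.relations)).2 ?_ hc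
    intro d hd
    obtain ⟨e, he, hrel⟩ := hT d hd
    have : d = e + (d - e) := by abel
    rw [this]
    exact AddSubgroup.add_mem_sup he hrel
  obtain ⟨b, hb, ρ, hρ, rfl⟩ := AddSubgroup.mem_sup.1 hsub
  have hρ0 : KZ.eval ρ = 0 := AddMonoidHom.mem_ker.1 (KZ.relations_le_ker_eval_holds hρ)
  have hb0 : KZ.eval b = 0 := by
    rw [map_add, hρ0, add_zero] at h0
    exact h0
  exact KZ.relations.add_mem (XMapKernelCells.realPeriodCellKernel_relations b hb hb0) hρ

#print axioms BiellipticRealPeriodCell_of_landed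

end Summit.KontsevichZagierPeriods.IsogenyCertificates.BiellipticRealPeriodCellStubs.AssemblySaCensus

end
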